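import Summits.QuantumFields.YangMills.Theorems.UnitScaleTiltProp7TransplantNorms
import HarnessLib

/-!
# Route `UnitScaleTilt`, crux K1 «MinimiserStabilityRegPr» (stmt-QuantumFields-19200), route-R E′ path (α′), (E1-b) at the CURVED background — near-field transplant, brick 3 «TRANSPLANT NORMS, GENERAL FIELD»:
# the `hs`-numbers of a frame-transported MATRIX field `z ↦ R(Fr z)(F z)` (the second generation `F = G̃₂ ∗ J̃₁` is matrix-valued): pointwise `√hs(Δ_U(R(Fr)F)) ≤ √hs(Δ_flat F) + √N·(frame junk in
# operator norms of F)`, its ℓ¹ sum with pointwise row functions, and the `ω²`-weighted twin — the same three shapes as ✓`…TransplantNorms` (scalar × constant), over ✓p674125's general lemma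

Cell `ym3-torus`, extra width seat `ym-routeR-w6` (gen 6).  THEOREMS ONLY (0 `def`, 0 `sorry`); `--supports stmt-QuantumFields-19200`, count-neutral.  YM₃ on T³ is a ladder rung (R3),
not the Clay problem; nothing here claims a stub, the crux, d = 4 or the mass gap.

WHAT IS PROVED (ns `…Theorems.Prop7TransplantNormsField`; torus `Site P i`, bi-contractive `U`, `Fr`; `hs X = Σ_j Σ_k ‖X j k‖²`; flat Laplacian `Δ_flat F x = Σ_μ((F x − F(T_μx)) + (F x − F(T_μ⁻¹x)))`).
* ★★★ `sqrt_hs_covLaplace_framed_le` — pointwise: `√hs(Δ_U(R(Fr ·)F)(x)) ≤ √hs(Δ_flat F x) + √N·Σ_μ[(2τ₂+4τ₁²)‖F x‖ + 2τ₁‖F(T_μx) − F x‖ + 2τ₁‖F(T_μ⁻¹x) − F x‖]`.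
* ★★★ `sum_sqrt_hs_covLaplace_framed_le` — ℓ¹ over the support with pointwise row functions `t₁ t₂`; ★★ `…_le_card_mul` (uniform `Φ₀ Φ₁ Φ₂`, `τ₁ τ₂`).
* ★★★ `sqrt_weighted_hs_covLaplace_framed_le` — `√(Σ ω²hs) ≤ Ω·√#S·(Φ₂ + √N·d·((2τ₂+4τ₁²)Φ₀ + 4τ₁Φ₁))`.
HONEST SCOPE.  Counting∕pointwise algebra over ✓p674125 `norm_covLaplace_framed_sub_flat_le`; flat inputs (FLAT-CONV ✓p673901∕p674389, ★w8 instances) are the consumer's.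

References: T. Bałaban, CMP 99 (1985) 389–434 [Balaban1985BackgroundPropagators] ((3.8) p.392, (3.28) p.395, (3.35) p.396); CMP 96 (1984) 223–250 [Balaban1984PropagatorsII] ((1.9) p.226).
-/

set_option autoImplicit false

noncomputable section

open scoped BigOperators Matrix.Norms.L2Operator Matrix

namespace Summit.QuantumFields.YangMills.Theorems.Prop7TransplantNormsField

open Literature.MathematicalPhysics.QuantumFieldTheory.Balaban1983to89
open B9Eq39Adjoint (R R_def covD covDstar divB)
open B9TorusCalculus (torusT torusT_apply torusT_symm_apply)
open Summit.QuantumFields.YangMills.Theorems.Prop7CovPinnedKernelL1OfRows (sqrt_hs_add_le)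
open Summit.QuantumFields.YangMills.Theorems.Prop7FramedScalarMatrix (norm_covLaplace_framed_sub_flat_le)
open Summit.QuantumFields.YangMills.Theorems.Prop7TransplantNorms (hs_R_le covLaplace_eq_zero_of_vanish)
open Summit.QuantumFields.YangMills.Theorems.Prop7HSOpNormSeam (sqrt_hs_le_sqrt_card_mul_norm)

variable {P : Params} {i : ℕ} {N : ℕ}

/-! ## §1 ★★★ Pointwise -/

/-- ★★★ **POINTWISE `√hs` OF `Δ_U(R(Fr ·)F)`** (general matrix field). [cite: Balaban1985BackgroundPropagators, (3.8) p.392, (3.28) p.395, (3.35) p.396] -/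
theorem sqrt_hs_covLaplace_framed_le (U : Fin P.d → Site P i → (Matrix (Fin N) (Fin N) ℂ)ˣ) (Fr : Site P i → (Matrix (Fin N) (Fin N) ℂ)ˣ)
    (hU : ∀ (κ : Fin P.d) (y : Site P i), ‖(U κ y : Matrix (Fin N) (Fin N) ℂ)‖ ≤ 1 ∧ ‖(((U κ y)⁻¹ : (Matrix (Fin N) (Fin N) ℂ)ˣ) : Matrix (Fin N) (Fin N) ℂ)‖ ≤ 1)
    (hFr : ∀ z : Site P i, ‖(Fr z : Matrix (Fin N) (Fin N) ℂ)‖ ≤ 1 ∧ ‖(((Fr z)⁻¹ : (Matrix (Fin N) (Fin N) ℂ)ˣ) : Matrix (Fin N) (Fin N) ℂ)‖ ≤ 1)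
    (F : Site P i → Matrix (Fin N) (Fin N) ℂ) (x : Site P i) {τ₁ τ₂ : ℝ}
    (h1 : ∀ μ, ‖(((Fr x)⁻¹ * U μ x * Fr (torusT P i μ x) : (Matrix (Fin N) (Fin N) ℂ)ˣ) : Matrix (Fin N) (Fin N) ℂ) - 1‖ ≤ τ₁)
    (h1' : ∀ μ, ‖(((Fr ((torusT P i μ).symm x))⁻¹ * U μ ((torusT P i μ).symm x) * Fr (torusT P i μ ((torusT P i μ).symm x)) : (Matrix (Fin N) (Fin N) ℂ)ˣ) :
      Matrix (Fin N) (Fin N) ℂ) - 1‖ ≤ τ₁)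
    (h2 : ∀ μ, ‖(((Fr x)⁻¹ * U μ x * Fr (torusT P i μ x) : (Matrix (Fin N) (Fin N) ℂ)ˣ) : Matrix (Fin N) (Fin N) ℂ)
      - (((Fr ((torusT P i μ).symm x))⁻¹ * U μ ((torusT P i μ).symm x) * Fr (torusT P i μ ((torusT P i μ).symm x)) : (Matrix (Fin N) (Fin N) ℂ)ˣ) :
        Matrix (Fin N) (Fin N) ℂ)‖ ≤ τ₂) :
    Real.sqrt (∑ j : Fin N, ∑ k : Fin N, ‖(divB (torusT P i) U (fun μ => covD (torusT P i) U μ (fun y => R (Fr y) (F y))) x) j k‖ ^ 2)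
      ≤ Real.sqrt (∑ j : Fin N, ∑ k : Fin N, ‖(∑ μ : Fin P.d, ((F x - F (torusT P i μ x)) + (F x - F ((torusT P i μ).symm x)))) j k‖ ^ 2) + Real.sqrt N * ∑ μ : Fin P.d, ((2 * τ₂ + 4 * τ₁ ^ 2) * ‖F x‖ + 2 * τ₁ * ‖F (torusT P i μ x) - F x‖ + 2 * τ₁ * ‖F ((torusT P i μ).symm x) - F x‖) := by
  set Z := divB (torusT P i) U (fun μ => covD (torusT P i) U μ (fun y => R (Fr y) (F y))) x with hZ
  set M := R (Fr x) (∑ μ : Fin P.d, ((F x - F (torusT P i μ x)) + (F x - F ((torusT P i μ).symm x)))) with hM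
  have hE : ‖Z - M‖ ≤ ∑ μ : Fin P.d, ((2 * τ₂ + 4 * τ₁ ^ 2) * ‖F x‖ + 2 * τ₁ * ‖F (torusT P i μ x) - F x‖ + 2 * τ₁ * ‖F ((torusT P i μ).symm x) - F x‖) :=
    norm_covLaplace_framed_sub_flat_le (torusT P i) U Fr hU hFr F x h1 h1' h2
  have e : Z = M + (Z - M) := by abel
  rw [e]
  refine (sqrt_hs_add_le M (Z - M)).trans (add_le_add ?_ ?_)
  · rw [hM]; exact Real.sqrt_le_sqrt (hs_R_le (hFr x) _)
  · exact (sqrt_hs_le_sqrt_card_mul_norm (Z - M)).trans (mul_le_mul_of_nonneg_left hE (Real.sqrt_nonneg _))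

/-! ## §2 ★★★ The ℓ¹ number -/

/-- ★★★ **ℓ¹ SUM** over the torus for `F` vanishing with its neighbours off `S`, pointwise row functions `t₁ t₂`. [cite: Balaban1985BackgroundPropagators, (3.35) p.396; Balaban1984PropagatorsII, (1.9) p.226] -/
theorem sum_sqrt_hs_covLaplace_framed_le (U : Fin P.d → Site P i → (Matrix (Fin N) (Fin N) ℂ)ˣ) (Fr : Site P i → (Matrix (Fin N) (Fin N) ℂ)ˣ)
    (hU : ∀ (κ : Fin P.d) (y : Site P i), ‖(U κ y : Matrix (Fin N) (Fin N) ℂ)‖ ≤ 1 ∧ ‖(((U κ y)⁻¹ : (Matrix (Fin N) (Fin N) ℂ)ˣ) : Matrix (Fin N) (Fin N) ℂ)‖ ≤ 1)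
    (hFr : ∀ z : Site P i, ‖(Fr z : Matrix (Fin N) (Fin N) ℂ)‖ ≤ 1 ∧ ‖(((Fr z)⁻¹ : (Matrix (Fin N) (Fin N) ℂ)ˣ) : Matrix (Fin N) (Fin N) ℂ)‖ ≤ 1)
    (F : Site P i → Matrix (Fin N) (Fin N) ℂ) (S : Finset (Site P i))
    (hS : ∀ z ∉ S, F z = 0 ∧ (∀ μ, F (torusT P i μ z) = 0) ∧ ∀ μ, F ((torusT P i μ).symm z) = 0)
    (t₁ t₂ : Site P i → ℝ)
    (h1 : ∀ z ∈ S, ∀ μ, ‖(((Fr z)⁻¹ * U μ z * Fr (torusT P i μ z) : (Matrix (Fin N) (Fin N) ℂ)ˣ) : Matrix (Fin N) (Fin N) ℂ) - 1‖ ≤ t₁ z)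
    (h1' : ∀ z ∈ S, ∀ μ, ‖(((Fr ((torusT P i μ).symm z))⁻¹ * U μ ((torusT P i μ).symm z) * Fr (torusT P i μ ((torusT P i μ).symm z)) : (Matrix (Fin N) (Fin N) ℂ)ˣ) :
      Matrix (Fin N) (Fin N) ℂ) - 1‖ ≤ t₁ z)
    (h2 : ∀ z ∈ S, ∀ μ, ‖(((Fr z)⁻¹ * U μ z * Fr (torusT P i μ z) : (Matrix (Fin N) (Fin N) ℂ)ˣ) : Matrix (Fin N) (Fin N) ℂ)
      - (((Fr ((torusT P i μ).symm z))⁻¹ * U μ ((torusT P i μ).symm z) * Fr (torusT P i μ ((torusT P i μ).symm z)) : (Matrix (Fin N) (Fin N) ℂ)ˣ) :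
        Matrix (Fin N) (Fin N) ℂ)‖ ≤ t₂ z) :
    ∑ z, Real.sqrt (∑ j : Fin N, ∑ k : Fin N, ‖(divB (torusT P i) U (fun μ => covD (torusT P i) U μ (fun y => R (Fr y) (F y))) z) j k‖ ^ 2)
      ≤ ∑ z ∈ S, Real.sqrt (∑ j : Fin N, ∑ k : Fin N, ‖(∑ μ : Fin P.d, ((F z - F (torusT P i μ z)) + (F z - F ((torusT P i μ).symm z)))) j k‖ ^ 2)
        + Real.sqrt N * ∑ z ∈ S, ∑ μ : Fin P.d, ((2 * t₂ z + 4 * t₁ z ^ 2) * ‖F z‖ + 2 * t₁ z * ‖F (torusT P i μ z) - F z‖ + 2 * t₁ z * ‖F ((torusT P i μ).symm z) - F z‖) := by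
  have hoff : ∀ z ∈ (Finset.univ : Finset (Site P i)), z ∉ S → Real.sqrt (∑ j : Fin N, ∑ k : Fin N, ‖(divB (torusT P i) U (fun μ => covD (torusT P i) U μ (fun y => R (Fr y) (F y))) z) j k‖ ^ 2) = 0 := by
    intro z _ hz
    obtain ⟨hz0, hz1, hz2⟩ := hS z hz
    rw [covLaplace_eq_zero_of_vanish U _ z (by show R _ (F z) = 0; rw [hz0, R_def, mul_zero, zero_mul])
      (fun μ => by show R _ (F _) = 0; rw [hz1 μ, R_def, mul_zero, zero_mul]) (fun μ => by show R _ (F _) = 0; rw [hz2 μ, R_def, mul_zero, zero_mul])]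
    simp
  rw [← Finset.sum_subset (Finset.subset_univ S) hoff, Finset.mul_sum, ← Finset.sum_add_distrib]
  exact Finset.sum_le_sum fun z hz => sqrt_hs_covLaplace_framed_le U Fr hU hFr F z (h1 z hz) (h1' z hz) (h2 z hz)

/-- ★★ **ℓ¹ SUM, UNIFORM BOUNDS**: `≤ #S·(Φ₂ + √N·d·((2τ₂+4τ₁²)Φ₀ + 4τ₁Φ₁))`. [cite: Balaban1985BackgroundPropagators, (3.35) p.396] -/
theorem sum_sqrt_hs_covLaplace_framed_le_card_mul (U : Fin P.d → Site P i → (Matrix (Fin N) (Fin N) ℂ)ˣ) (Fr : Site P i → (Matrix (Fin N) (Fin N) ℂ)ˣ)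
    (hU : ∀ (κ : Fin P.d) (y : Site P i), ‖(U κ y : Matrix (Fin N) (Fin N) ℂ)‖ ≤ 1 ∧ ‖(((U κ y)⁻¹ : (Matrix (Fin N) (Fin N) ℂ)ˣ) : Matrix (Fin N) (Fin N) ℂ)‖ ≤ 1)
    (hFr : ∀ z : Site P i, ‖(Fr z : Matrix (Fin N) (Fin N) ℂ)‖ ≤ 1 ∧ ‖(((Fr z)⁻¹ : (Matrix (Fin N) (Fin N) ℂ)ˣ) : Matrix (Fin N) (Fin N) ℂ)‖ ≤ 1)
    (F : Site P i → Matrix (Fin N) (Fin N) ℂ) (S : Finset (Site P i))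
    (hS : ∀ z ∉ S, F z = 0 ∧ (∀ μ, F (torusT P i μ z) = 0) ∧ ∀ μ, F ((torusT P i μ).symm z) = 0)
    {τ₁ τ₂ Φ₀ Φ₁ Φ₂ : ℝ} (hτ₁ : 0 ≤ τ₁)
    (h1 : ∀ z ∈ S, ∀ μ, ‖(((Fr z)⁻¹ * U μ z * Fr (torusT P i μ z) : (Matrix (Fin N) (Fin N) ℂ)ˣ) : Matrix (Fin N) (Fin N) ℂ) - 1‖ ≤ τ₁)
    (h1' : ∀ z ∈ S, ∀ μ, ‖(((Fr ((torusT P i μ).symm z))⁻¹ * U μ ((torusT P i μ).symm z) * Fr (torusT P i μ ((torusT P i μ).symm z)) : (Matrix (Fin N) (Fin N) ℂ)ˣ) :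
      Matrix (Fin N) (Fin N) ℂ) - 1‖ ≤ τ₁)
    (h2 : ∀ z ∈ S, ∀ μ, ‖(((Fr z)⁻¹ * U μ z * Fr (torusT P i μ z) : (Matrix (Fin N) (Fin N) ℂ)ˣ) : Matrix (Fin N) (Fin N) ℂ)
      - (((Fr ((torusT P i μ).symm z))⁻¹ * U μ ((torusT P i μ).symm z) * Fr (torusT P i μ ((torusT P i μ).symm z)) : (Matrix (Fin N) (Fin N) ℂ)ˣ) :
        Matrix (Fin N) (Fin N) ℂ)‖ ≤ τ₂)
    (hΦ₀ : ∀ z ∈ S, ‖F z‖ ≤ Φ₀) (hΦ₁ : ∀ z ∈ S, ∀ μ, ‖F (torusT P i μ z) - F z‖ ≤ Φ₁ ∧ ‖F ((torusT P i μ).symm z) - F z‖ ≤ Φ₁)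
    (hΦ₂ : ∀ z ∈ S, Real.sqrt (∑ j : Fin N, ∑ k : Fin N, ‖(∑ μ : Fin P.d, ((F z - F (torusT P i μ z)) + (F z - F ((torusT P i μ).symm z)))) j k‖ ^ 2) ≤ Φ₂) :
    ∑ z, Real.sqrt (∑ j : Fin N, ∑ k : Fin N, ‖(divB (torusT P i) U (fun μ => covD (torusT P i) U μ (fun y => R (Fr y) (F y))) z) j k‖ ^ 2)
      ≤ S.card * (Φ₂ + Real.sqrt N * (P.d * ((2 * τ₂ + 4 * τ₁ ^ 2) * Φ₀ + 4 * τ₁ * Φ₁))) := by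
  have h := sum_sqrt_hs_covLaplace_framed_le U Fr hU hFr F S hS (fun _ => τ₁) (fun _ => τ₂) h1 h1' h2
  refine h.trans ?_
  have hτ₂ : ∀ z ∈ S, 0 ≤ τ₂ := fun z hz => by
    obtain ⟨μ⟩ := (inferInstance : Nonempty (Fin P.d))
    exact (norm_nonneg _).trans (h2 z hz μ)
  have hA : ∑ z ∈ S, Real.sqrt (∑ j : Fin N, ∑ k : Fin N, ‖(∑ μ : Fin P.d, ((F z - F (torusT P i μ z)) + (F z - F ((torusT P i μ).symm z)))) j k‖ ^ 2) ≤ S.card * Φ₂ := by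
    calc _ ≤ ∑ z ∈ S, Φ₂ := Finset.sum_le_sum hΦ₂
      _ = S.card * Φ₂ := by rw [Finset.sum_const, nsmul_eq_mul]
  have hB : ∑ z ∈ S, ∑ μ : Fin P.d, ((2 * τ₂ + 4 * τ₁ ^ 2) * ‖F z‖ + 2 * τ₁ * ‖F (torusT P i μ z) - F z‖ + 2 * τ₁ * ‖F ((torusT P i μ).symm z) - F z‖)
      ≤ S.card * (P.d * ((2 * τ₂ + 4 * τ₁ ^ 2) * Φ₀ + 4 * τ₁ * Φ₁)) := by
    calc _ ≤ ∑ z ∈ S, ∑ _μ : Fin P.d, ((2 * τ₂ + 4 * τ₁ ^ 2) * Φ₀ + 2 * τ₁ * Φ₁ + 2 * τ₁ * Φ₁) := by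
          refine Finset.sum_le_sum fun z hz => Finset.sum_le_sum fun μ _ => ?_
          have hc : 0 ≤ 2 * τ₂ + 4 * τ₁ ^ 2 := by nlinarith [hτ₂ z hz, sq_nonneg τ₁]
          gcongr
          · exact hΦ₀ z hz
          · exact (hΦ₁ z hz μ).1
          · exact (hΦ₁ z hz μ).2
      _ = S.card * (P.d * ((2 * τ₂ + 4 * τ₁ ^ 2) * Φ₀ + 4 * τ₁ * Φ₁)) := by
          simp only [Finset.sum_const, Finset.card_univ, Fintype.card_fin, nsmul_eq_mul]; ring
  have hN : 0 ≤ Real.sqrt (N : ℝ) := Real.sqrt_nonneg _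
  calc _ ≤ S.card * Φ₂ + Real.sqrt N * (S.card * (P.d * ((2 * τ₂ + 4 * τ₁ ^ 2) * Φ₀ + 4 * τ₁ * Φ₁))) := by gcongr
    _ = _ := by ring

/-! ## §3 ★★★ The `ω²`-weighted number -/

/-- ★★★ **WEIGHTED ℓ² NUMBER** under `0 ≤ ω ≤ Ω` on `S`: `√(Σ ω²·hs(Δ_U(R(Fr)F))) ≤ Ω·√#S·(Φ₂ + √N·d·((2τ₂+4τ₁²)Φ₀ + 4τ₁Φ₁))`. [cite: Balaban1984PropagatorsII, (1.9) p.226; Balaban1985BackgroundPropagators, (3.35) p.396] -/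
theorem sqrt_weighted_hs_covLaplace_framed_le (U : Fin P.d → Site P i → (Matrix (Fin N) (Fin N) ℂ)ˣ) (Fr : Site P i → (Matrix (Fin N) (Fin N) ℂ)ˣ)
    (hU : ∀ (κ : Fin P.d) (y : Site P i), ‖(U κ y : Matrix (Fin N) (Fin N) ℂ)‖ ≤ 1 ∧ ‖(((U κ y)⁻¹ : (Matrix (Fin N) (Fin N) ℂ)ˣ) : Matrix (Fin N) (Fin N) ℂ)‖ ≤ 1)
    (hFr : ∀ z : Site P i, ‖(Fr z : Matrix (Fin N) (Fin N) ℂ)‖ ≤ 1 ∧ ‖(((Fr z)⁻¹ : (Matrix (Fin N) (Fin N) ℂ)ˣ) : Matrix (Fin N) (Fin N) ℂ)‖ ≤ 1)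
    (F : Site P i → Matrix (Fin N) (Fin N) ℂ) (S : Finset (Site P i))
    (hS : ∀ z ∉ S, F z = 0 ∧ (∀ μ, F (torusT P i μ z) = 0) ∧ ∀ μ, F ((torusT P i μ).symm z) = 0)
    (ω : Site P i → ℝ) {Ω : ℝ} (hω : ∀ z ∈ S, 0 ≤ ω z ∧ ω z ≤ Ω)
    {τ₁ τ₂ Φ₀ Φ₁ Φ₂ : ℝ} (hτ₁ : 0 ≤ τ₁)
    (h1 : ∀ z ∈ S, ∀ μ, ‖(((Fr z)⁻¹ * U μ z * Fr (torusT P i μ z) : (Matrix (Fin N) (Fin N) ℂ)ˣ) : Matrix (Fin N) (Fin N) ℂ) - 1‖ ≤ τ₁)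
    (h1' : ∀ z ∈ S, ∀ μ, ‖(((Fr ((torusT P i μ).symm z))⁻¹ * U μ ((torusT P i μ).symm z) * Fr (torusT P i μ ((torusT P i μ).symm z)) : (Matrix (Fin N) (Fin N) ℂ)ˣ) :
      Matrix (Fin N) (Fin N) ℂ) - 1‖ ≤ τ₁)
    (h2 : ∀ z ∈ S, ∀ μ, ‖(((Fr z)⁻¹ * U μ z * Fr (torusT P i μ z) : (Matrix (Fin N) (Fin N) ℂ)ˣ) : Matrix (Fin N) (Fin N) ℂ)
      - (((Fr ((torusT P i μ).symm z))⁻¹ * U μ ((torusT P i μ).symm z) * Fr (torusT P i μ ((torusT P i μ).symm z)) : (Matrix (Fin N) (Fin N) ℂ)ˣ) :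
        Matrix (Fin N) (Fin N) ℂ)‖ ≤ τ₂)
    (hΦ₀ : ∀ z ∈ S, ‖F z‖ ≤ Φ₀) (hΦ₁ : ∀ z ∈ S, ∀ μ, ‖F (torusT P i μ z) - F z‖ ≤ Φ₁ ∧ ‖F ((torusT P i μ).symm z) - F z‖ ≤ Φ₁)
    (hΦ₂ : ∀ z ∈ S, Real.sqrt (∑ j : Fin N, ∑ k : Fin N, ‖(∑ μ : Fin P.d, ((F z - F (torusT P i μ z)) + (F z - F ((torusT P i μ).symm z)))) j k‖ ^ 2) ≤ Φ₂) :
    Real.sqrt (∑ z, ω z ^ 2 * ∑ j : Fin N, ∑ k : Fin N, ‖(divB (torusT P i) U (fun μ => covD (torusT P i) U μ (fun y => R (Fr y) (F y))) z) j k‖ ^ 2)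
      ≤ Ω * Real.sqrt S.card * (Φ₂ + Real.sqrt N * (P.d * ((2 * τ₂ + 4 * τ₁ ^ 2) * Φ₀ + 4 * τ₁ * Φ₁))) := by
  set B := Φ₂ + Real.sqrt N * (P.d * ((2 * τ₂ + 4 * τ₁ ^ 2) * Φ₀ + 4 * τ₁ * Φ₁)) with hBdef
  have hpt : ∀ z ∈ S, Real.sqrt (∑ j : Fin N, ∑ k : Fin N, ‖(divB (torusT P i) U (fun μ => covD (torusT P i) U μ (fun y => R (Fr y) (F y))) z) j k‖ ^ 2) ≤ B := by
    intro z hz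
    have h := sqrt_hs_covLaplace_framed_le U Fr hU hFr F z (h1 z hz) (h1' z hz) (h2 z hz)
    refine h.trans ?_
    have hτ₂ : 0 ≤ τ₂ := by
      obtain ⟨μ⟩ := (inferInstance : Nonempty (Fin P.d))
      exact (norm_nonneg _).trans (h2 z hz μ)
    have hsum : ∑ μ : Fin P.d, ((2 * τ₂ + 4 * τ₁ ^ 2) * ‖F z‖ + 2 * τ₁ * ‖F (torusT P i μ z) - F z‖ + 2 * τ₁ * ‖F ((torusT P i μ).symm z) - F z‖)
        ≤ P.d * ((2 * τ₂ + 4 * τ₁ ^ 2) * Φ₀ + 4 * τ₁ * Φ₁) := by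
      calc _ ≤ ∑ _μ : Fin P.d, ((2 * τ₂ + 4 * τ₁ ^ 2) * Φ₀ + 2 * τ₁ * Φ₁ + 2 * τ₁ * Φ₁) := by
            refine Finset.sum_le_sum fun μ _ => ?_
            have hc : 0 ≤ 2 * τ₂ + 4 * τ₁ ^ 2 := by nlinarith [sq_nonneg τ₁]
            gcongr
            · exact hΦ₀ z hz
            · exact (hΦ₁ z hz μ).1
            · exact (hΦ₁ z hz μ).2
        _ = _ := by rw [Finset.sum_const, Finset.card_univ, Fintype.card_fin, nsmul_eq_mul]; ring
    have hN : 0 ≤ Real.sqrt (N : ℝ) := Real.sqrt_nonneg _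
    calc _ ≤ Φ₂ + Real.sqrt N * (P.d * ((2 * τ₂ + 4 * τ₁ ^ 2) * Φ₀ + 4 * τ₁ * Φ₁)) := by gcongr; exact hΦ₂ z hz
      _ = B := by rw [hBdef]
  have hoff : ∀ z ∈ (Finset.univ : Finset (Site P i)), z ∉ S → ω z ^ 2 * ∑ j : Fin N, ∑ k : Fin N, ‖(divB (torusT P i) U (fun μ => covD (torusT P i) U μ (fun y => R (Fr y) (F y))) z) j k‖ ^ 2 = 0 := by
    intro z _ hz
    obtain ⟨hz0, hz1, hz2⟩ := hS z hz
    rw [covLaplace_eq_zero_of_vanish U _ z (by show R _ (F z) = 0; rw [hz0, R_def, mul_zero, zero_mul])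
      (fun μ => by show R _ (F _) = 0; rw [hz1 μ, R_def, mul_zero, zero_mul]) (fun μ => by show R _ (F _) = 0; rw [hz2 μ, R_def, mul_zero, zero_mul])]
    simp
  rw [← Finset.sum_subset (Finset.subset_univ S) hoff]
  have hle : ∑ z ∈ S, ω z ^ 2 * ∑ j : Fin N, ∑ k : Fin N, ‖(divB (torusT P i) U (fun μ => covD (torusT P i) U μ (fun y => R (Fr y) (F y))) z) j k‖ ^ 2 ≤ ∑ _z ∈ S, Ω ^ 2 * B ^ 2 := by
    refine Finset.sum_le_sum fun z hz => ?_
    have h0 : 0 ≤ ∑ j : Fin N, ∑ k : Fin N, ‖(divB (torusT P i) U (fun μ => covD (torusT P i) U μ (fun y => R (Fr y) (F y))) z) j k‖ ^ 2 := Finset.sum_nonneg fun _ _ => Finset.sum_nonneg fun _ _ => sq_nonneg _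
    have hhs : ∑ j : Fin N, ∑ k : Fin N, ‖(divB (torusT P i) U (fun μ => covD (torusT P i) U μ (fun y => R (Fr y) (F y))) z) j k‖ ^ 2 ≤ B ^ 2 := by
      rw [← Real.sq_sqrt h0]
      exact pow_le_pow_left₀ (Real.sqrt_nonneg _) (hpt z hz) 2
    have hω2 : ω z ^ 2 ≤ Ω ^ 2 := pow_le_pow_left₀ (hω z hz).1 (hω z hz).2 2
    exact mul_le_mul hω2 hhs h0 (sq_nonneg _)
  rcases S.eq_empty_or_nonempty with hS0 | ⟨z₀, hz₀⟩
  · subst hS0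
    rw [Finset.sum_empty, Real.sqrt_zero, Finset.card_empty, Nat.cast_zero, Real.sqrt_zero, mul_zero, zero_mul]
  have hΩ : 0 ≤ Ω := (hω z₀ hz₀).1.trans (hω z₀ hz₀).2
  have hB0 : 0 ≤ B := (Real.sqrt_nonneg _).trans (hpt z₀ hz₀)
  calc _ ≤ Real.sqrt (∑ _z ∈ S, Ω ^ 2 * B ^ 2) := Real.sqrt_le_sqrt hle
    _ = Ω * Real.sqrt S.card * B := by
        rw [Finset.sum_const, nsmul_eq_mul, show (S.card : ℝ) * (Ω ^ 2 * B ^ 2) = (Ω * Real.sqrt S.card * B) ^ 2 by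
          rw [mul_pow, mul_pow, Real.sq_sqrt (Nat.cast_nonneg _)]; ring]
        exact Real.sqrt_sq (mul_nonneg (mul_nonneg hΩ (Real.sqrt_nonneg _)) hB0)

end Summit.QuantumFields.YangMills.Theorems.Prop7TransplantNormsField

end
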